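/- Copyright: the b2b-balaban cell (near-miss cell 7), T⁴-continuum fan-out, lineage t4-ne7b-p1 (row NE7b OWNER, gen 47).
Released under the licence of the surrounding project. -/
import Summits.QuantumFields.BalabanUV.T4Continuum.Support.B16HistoryIndexedTrunc

/-!
# The truncation aggregate, part 2: KEYED truncation — run B's numerator fields from run B's OWN key reading and the
KEY MULTIPLICITY (re-open object (α) of row NE7b, `SCOPE-alpha.md` §5 row M2, brick C part 2; rulings R-OWNER-46-2 ∕
R-OWNER-47-2 (D); INTERFACE REQUEST IR-46-2 «THE (α) ASSEMBLY», run-B side v0.5 → v0.75) — PRE-POSITIONING ONLY; owner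
lineage `t4-ne7b-p1` gen 47

Summits-side support leaf of the T⁴-continuum cell (rung (B)+1 on a FINITE torus only; NOT infinite volume, NOT the
mass gap, NOT Clay; NOT a proof of NE7b — the cell's OWN estimate, NOT PRINTED, NOT PROVED).  [folklore] finite-sum
bookkeeping over part 1 (`B16HistoryIndexedTrunc`: `aggW`, `sum_aggW_eq_sum_filter`, `upM'_of_trunc`) and the Literature
fibre `T4LiveClassFibration.fibre`; nothing printed asserted, no `def … : Prop` fact of Bałaban's, no cite-tagged
hypothesis, zero `sorry`.

WHY.  Part 1 made the END's run-B fields `reprB`∕`upM'`∕`deadM'_nonneg`∕`resumM'` kernel modulo run B's per-term readings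
KEYED AT RUN A's KEYS («TRUNC», R) — i.e. modulo NODE O's matching.  This part factors that matching through run B's OWN
key reading `kmem' K : ι' → κ'` (M2-B applied to run B: the physical live member family of a run-B term) and ONE KEY
TRUNCATION `ktrunc K : κ' → κ` COMPATIBLE with the term truncation (`kmem K (trunc K τ') = ktrunc K (kmem' K τ')`: the
live family of the truncated history is the truncation of the live family).  Then: (i) the composite fibre of a run-A
key `k` is the UNION of run B's own key fibres over the run-B keys `k' ↦ k` (`truncFibre_eq_keyFilter`,
`sum_truncFibre_eq_sum_keys`); (ii) the END's `resumM'` follows from run B's OWN per-key fibre-mass display (ρ_B) — the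
SAME display as run A's (ρ), for run B — with `RfM' K k := Σ_{k' ↦ k} B' K k'` (**`resumM'_of_keyFibreMass`**), and under
a uniform per-key bound with the KEY MULTIPLICITY `keyMult K k = #{k' ∈ keys' K ∣ ktrunc K k' = k}` as a factor
(**`resumM'_of_keyFibreMass_unif`**) — THIS is where NE-R1's «resummed UV factor per step» enters BY NAME (the number of
level-`(K+1)` live families refining one level-`K` live family); (iii) the END's `upM'` follows from run B's OWN
numerator reading at its own keys plus ONE key-domination display `LIVE' K k' ≤ FcM' K (ktrunc K k')`
(**`upM'_of_keyDomination`**; dead weights and envelope non-negative).  So the R-class word «TRUNC» of part 1 SPLITS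
into: `trunc`∕`ktrunc` DATA with `MapsTo` + compatibility (S, NODE O), run B's own (ρ_B) (R, volume type), the key
domination (R∕K°: run B's live price at its constants against run A's price letters), and `keyMult` (S∕K°: a COUNT).

WHAT (all [folklore]).  §1 `keys'`, `keyMult`, the compatibility consequence `mem_truncFibre_iff_ktrunc`,
**`truncFibre_eq_keyFilter`**, **`sum_truncFibre_eq_sum_keys`** (fiberwise over `kmem'`); §2 **`resumM'_of_keyFibreMass`**,
`sum_filter_keys_le_keyMult_mul`, **`resumM'_of_keyFibreMass_unif`**; §3 **`upM'_of_keyDomination`**,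
`deadM'_nonneg_of_nonneg`; §4 decided toy (two run-B keys over one run-A key: `keyMult = 2`).

BY-NAME EFFECT ON THE WALL (`WALL-NE7b-P1.md` §2, run-B rows, refining part 1): `resumM'` K modulo {(ρ_B) = run B's own
fibre-mass display, `trunc`∕`ktrunc` + compatibility (S), `keyMult` (a count; S∕K°)}; `upM'` K modulo {run B's own
numerator reading (as run A's: `HistRead_B`, `FactorRead_B`, volume calibrations), the key-domination display (R∕K°)}.
Nothing else moves; NE7b NOT PROVED by this.

HONEST DEPENDENCY (cell): continuum YM on T⁴ ⇐ BetaPertH ∧ nine spine estimates (0/9 proved); BetaPertH ⇐ (D1) ∧ (D4)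
∧ CAP+tail; G-an2-4 gates asym, D1 and NE2/3/4.  This file changes none of it.
-/

open Finset
open Literature.MathematicalPhysics.QuantumFieldTheory.Balaban1983to89
open Literature.MathematicalPhysics.QuantumFieldTheory.Balaban1983to89.T4LiveClassFibration (fibre mem_fibre)
open Summit.QuantumFields.BalabanUV.T4Continuum.B16HistoryIndexedTrunc

namespace Summit.QuantumFields.BalabanUV.T4Continuum.B16HistoryIndexedTruncKeys

noncomputable section

/-! ## §1 Run B's own keys, the key truncation, the composite fibre as a union of key fibres -/

section Keys

variable {ι ι' κ κ' : Type*} [DecidableEq ι] [DecidableEq κ] [DecidableEq κ']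
  {trunc : ℕ → ι' → ι} {S : ℕ → Finset ι'} {T : ℕ → Finset ι} {kmem : ℕ → ι → κ} {kmem' : ℕ → ι' → κ'}
  {ktrunc : ℕ → κ' → κ} {K : ℕ} {t : ℝ} {k : κ}

variable (S kmem') in
/-- **RUN B's OWN KEYS at cutoff `K`**: the key families of run B's terms ([our object]; for the reading: the
`kmemOf`-families of run B's level-`(K+1)` histories). [folklore] -/
def keys' (K : ℕ) : Finset κ' := (S K).image (kmem' K)

variable (S kmem' ktrunc) in
/-- **THE KEY MULTIPLICITY of a run-A key `k`**: the number of run-B keys truncating to `k` ([our object]; NE-R1's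
«resummed UV factor per step» is a bound on it). [folklore] -/
def keyMult (K : ℕ) (k : κ) : ℕ := ((keys' S kmem' K).filter fun k' => ktrunc K k' = k).card

/-- membership in run B's keys [folklore] -/
theorem mem_keys' {k' : κ'} : k' ∈ keys' S kmem' K ↔ ∃ τ' ∈ S K, kmem' K τ' = k' := mem_image

/-- the key of a run-B term is a run-B key [folklore] -/
theorem kmem'_mem_keys' {τ' : ι'} (h : τ' ∈ S K) : kmem' K τ' ∈ keys' S kmem' K := mem_image_of_mem _ h

omit [DecidableEq ι] [DecidableEq κ'] in
/-- **COMPATIBILITY ⟹ THE COMPOSITE FIBRE IS READ ON RUN B's KEYS**: under `MapsTo (trunc K) (S K) (T K)` and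
`kmem K (trunc K τ') = ktrunc K (kmem' K τ')`, a run-B term lies over the run-A fibre of `k` iff its OWN key truncates
to `k`. [folklore] -/
theorem mem_truncFibre_iff_ktrunc (htr : ∀ τ' ∈ S K, trunc K τ' ∈ T K)
    (hcompat : ∀ τ' ∈ S K, kmem K (trunc K τ') = ktrunc K (kmem' K τ')) {τ' : ι'} (hτ' : τ' ∈ S K) :
    trunc K τ' ∈ fibre kmem T K k ↔ ktrunc K (kmem' K τ') = k := by
  rw [mem_fibre, ← hcompat τ' hτ']
  exact ⟨fun h => h.2, fun h => ⟨htr τ' hτ', h⟩⟩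

omit [DecidableEq κ'] in
/-- **THE COMPOSITE FIBRE AS A KEY FILTER** (finset form of the previous lemma). [folklore] -/
theorem truncFibre_eq_keyFilter (htr : ∀ τ' ∈ S K, trunc K τ' ∈ T K)
    (hcompat : ∀ τ' ∈ S K, kmem K (trunc K τ') = ktrunc K (kmem' K τ')) :
    (S K).filter (fun τ' => trunc K τ' ∈ fibre kmem T K k) =
      (S K).filter (fun τ' => ktrunc K (kmem' K τ') = k) :=
  Finset.filter_congr fun _ hτ' => mem_truncFibre_iff_ktrunc htr hcompat hτ'

/-- **THE COMPOSITE FIBRE IS THE UNION OF RUN B's KEY FIBRES OVER `k' ↦ k`** (sum form, fiberwise over `kmem' K`):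
`Σ_{τ' ∈ S K, ktrunc (kmem' τ') = k} d τ' = Σ_{k' ∈ keys' K, ktrunc k' = k} Σ_{τ' ∈ fibre kmem' S K k'} d τ'`. [folklore] -/
theorem sum_keyFilter_eq_sum_keys (d : ℕ → ℝ → ι' → ℝ) :
    ∑ τ' ∈ (S K).filter (fun τ' => ktrunc K (kmem' K τ') = k), d K t τ' =
      ∑ k' ∈ (keys' S kmem' K).filter (fun k' => ktrunc K k' = k), ∑ τ' ∈ fibre kmem' S K k', d K t τ' := by
  have hmaps : ∀ τ' ∈ (S K).filter (fun τ' => ktrunc K (kmem' K τ') = k),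
      kmem' K τ' ∈ (keys' S kmem' K).filter (fun k' => ktrunc K k' = k) := fun τ' h =>
    mem_filter.2 ⟨kmem'_mem_keys' (mem_filter.1 h).1, (mem_filter.1 h).2⟩
  rw [← Finset.sum_fiberwise_of_maps_to hmaps]
  refine Finset.sum_congr rfl fun k' hk' => Finset.sum_congr ?_ fun _ _ => rfl
  have hk : ktrunc K k' = k := (mem_filter.1 hk').2
  rw [Finset.filter_filter]
  unfold fibre
  exact Finset.filter_congr fun τ' _ => ⟨fun h => h.2, fun h => ⟨h ▸ hk, h⟩⟩

/-- **THE COMPOSITE FIBRE SUM ON RUN B's KEYS** (the two previous lemmas composed): under `MapsTo` + compatibility,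
`Σ_{τ' ∈ S K, trunc τ' ∈ fibre kmem T K k} d τ' = Σ_{k' ↦ k} Σ_{τ' ∈ fibre kmem' S K k'} d τ'`. [folklore] -/
theorem sum_truncFibre_eq_sum_keys (htr : ∀ τ' ∈ S K, trunc K τ' ∈ T K)
    (hcompat : ∀ τ' ∈ S K, kmem K (trunc K τ') = ktrunc K (kmem' K τ')) (d : ℕ → ℝ → ι' → ℝ) :
    ∑ τ' ∈ (S K).filter (fun τ' => trunc K τ' ∈ fibre kmem T K k), d K t τ' =
      ∑ k' ∈ (keys' S kmem' K).filter (fun k' => ktrunc K k' = k), ∑ τ' ∈ fibre kmem' S K k', d K t τ' := by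
  rw [truncFibre_eq_keyFilter htr hcompat, sum_keyFilter_eq_sum_keys]

end Keys

/-! ## §2 The END's `resumM'` from run B's OWN fibre-mass display and the key multiplicity -/

section Resum

variable {ι ι' κ κ' : Type*} [DecidableEq ι] [DecidableEq κ] [DecidableEq κ']
  {trunc : ℕ → ι' → ι} {S : ℕ → Finset ι'} {T : ℕ → Finset ι} {kmem : ℕ → ι → κ} {kmem' : ℕ → ι' → κ'}
  {ktrunc : ℕ → κ' → κ} {K : ℕ} {t : ℝ} {k : κ} {d : ℕ → ℝ → ι' → ℝ}

/-- **THE END's `resumM'` FROM RUN B's OWN PER-KEY FIBRE-MASS DISPLAY (ρ_B)**: if run B's dead mass over each of ITS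
OWN key fibres is bounded by `B' K k'`, then the aggregated dead weights over the run-A fibre of `k` are bounded by
`Σ_{k' ↦ k} B' K k'` — the END's `resumM'` with `RfM' K k := Σ_{k' ∈ keys' K, ktrunc k' = k} B' K k'`. [folklore] -/
theorem resumM'_of_keyFibreMass (htr : ∀ τ' ∈ S K, trunc K τ' ∈ T K)
    (hcompat : ∀ τ' ∈ S K, kmem K (trunc K τ') = ktrunc K (kmem' K τ')) (B' : ℕ → κ' → ℝ)
    (hρ : ∀ k' ∈ keys' S kmem' K, ∑ τ' ∈ fibre kmem' S K k', d K t τ' ≤ B' K k') :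
    ∑ τ ∈ fibre kmem T K k, aggW trunc S d K t τ ≤
      ∑ k' ∈ (keys' S kmem' K).filter (fun k' => ktrunc K k' = k), B' K k' := by
  rw [sum_fibre_aggW_eq, sum_truncFibre_eq_sum_keys htr hcompat]
  exact Finset.sum_le_sum fun k' hk' => hρ k' (mem_filter.1 hk').1

/-- a uniform per-key bound over the keys `k' ↦ k` sums to the KEY MULTIPLICITY times the bound [folklore] -/
theorem sum_filter_keys_le_keyMult_mul (B' : ℕ → κ' → ℝ) {M : ℝ}
    (hM : ∀ k' ∈ keys' S kmem' K, ktrunc K k' = k → B' K k' ≤ M) :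
    ∑ k' ∈ (keys' S kmem' K).filter (fun k' => ktrunc K k' = k), B' K k' ≤ (keyMult S kmem' ktrunc K k : ℝ) * M := by
  have h := Finset.sum_le_card_nsmul ((keys' S kmem' K).filter fun k' => ktrunc K k' = k) (fun k' => B' K k') M
    fun k' hk' => hM k' (mem_filter.1 hk').1 (mem_filter.1 hk').2
  rwa [nsmul_eq_mul] at h

/-- **THE END's `resumM'` WITH THE KEY MULTIPLICITY AS A FACTOR**: a UNIFORM per-key fibre-mass bound `M K k` over the
run-B keys truncating to `k` gives `Σ_{τ ∈ fibre k} aggW dead' ≤ keyMult K k · M K k` — NE-R1's «resummed UV factor per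
step» is (a bound on) `keyMult`. [folklore] -/
theorem resumM'_of_keyFibreMass_unif (htr : ∀ τ' ∈ S K, trunc K τ' ∈ T K)
    (hcompat : ∀ τ' ∈ S K, kmem K (trunc K τ') = ktrunc K (kmem' K τ')) (M : ℕ → κ → ℝ)
    (hρ : ∀ k' ∈ keys' S kmem' K, ktrunc K k' = k → ∑ τ' ∈ fibre kmem' S K k', d K t τ' ≤ M K k) :
    ∑ τ ∈ fibre kmem T K k, aggW trunc S d K t τ ≤ (keyMult S kmem' ktrunc K k : ℝ) * M K k := by
  rw [sum_fibre_aggW_eq, sum_truncFibre_eq_sum_keys htr hcompat]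
  exact sum_filter_keys_le_keyMult_mul (fun K k' => ∑ τ' ∈ fibre kmem' S K k', d K t τ') hρ

end Resum

/-! ## §3 The END's `upM'` from run B's OWN numerator reading and ONE key-domination display -/

section Up

variable {ι ι' κ κ' : Type*} [DecidableEq ι] [DecidableEq κ] [DecidableEq κ']
  {trunc : ℕ → ι' → ι} {S : ℕ → Finset ι'} {T : ℕ → Finset ι} {kmem : ℕ → ι → κ} {kmem' : ℕ → ι' → κ'}
  {ktrunc : ℕ → κ' → κ} {K : ℕ} {t : ℝ} {k : κ} {w d : ℕ → ℝ → ι' → ℝ}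

/-- **THE END's `upM'` FROM RUN B's OWN NUMERATOR READING + KEY DOMINATION**: run B's per-term reading at ITS OWN keys
`w τ' ≤ dead' τ' · LIVE' K (kmem' τ') · mup K t` (the shape of run A's `upM` — M2-B∕M5 applied to run B), non-negative
dead weights and envelope, and ONE display `LIVE' K k' ≤ FcM' K (ktrunc K k')` (run B's key-level live price dominated
by the price letter booked at the truncated key) give the END's `upM'` for the aggregates over every run-A fibre.
[folklore] -/
theorem upM'_of_keyDomination (htr : ∀ τ' ∈ S K, trunc K τ' ∈ T K)
    (hcompat : ∀ τ' ∈ S K, kmem K (trunc K τ') = ktrunc K (kmem' K τ'))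
    (LIVE' : ℕ → κ' → ℝ) (FcM' : ℕ → κ → ℝ) (mup : ℕ → ℝ → ℝ)
    (hup : ∀ τ' ∈ S K, w K t τ' ≤ d K t τ' * LIVE' K (kmem' K τ') * mup K t)
    (hd : ∀ τ' ∈ S K, 0 ≤ d K t τ') (hm : 0 ≤ mup K t)
    (hdom : ∀ k' ∈ keys' S kmem' K, LIVE' K k' ≤ FcM' K (ktrunc K k')) :
    ∀ τ ∈ fibre kmem T K k, aggW trunc S w K t τ ≤ aggW trunc S d K t τ * FcM' K k * mup K t := by
  refine upM'_of_trunc FcM' mup fun τ' hτ' hk => (hup τ' hτ').trans ?_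
  have hkey : ktrunc K (kmem' K τ') = k := (mem_truncFibre_iff_ktrunc htr hcompat hτ').1 hk
  rw [← hkey]
  exact mul_le_mul_of_nonneg_right (mul_le_mul_of_nonneg_left (hdom _ (kmem'_mem_keys' hτ')) (hd τ' hτ')) hm

/-- **THE END's `deadM'_nonneg` FROM RUN B's OWN**: non-negative run-B dead weights aggregate to non-negative dead
weights on every run-A fibre (part 1's `deadM'_nonneg_of_trunc`, hypothesis simplified). [folklore] -/
theorem deadM'_nonneg_of_nonneg (hd : ∀ τ' ∈ S K, 0 ≤ d K t τ') :
    ∀ τ ∈ fibre kmem T K k, 0 ≤ aggW trunc S d K t τ :=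
  deadM'_nonneg_of_trunc fun τ' hτ' _ => hd τ' hτ'

/-- the key-domination display is inhabited by the MAXIMAL run-B live price over the keys truncating to each run-A key
(finite maximum; a K°-class instantiation when run B's prices are given) — recorded as the canonical choice of
`FcM'` when no sharper letter is booked. [folklore] -/
theorem keyDomination_sup (LIVE' : ℕ → κ' → ℝ) (hL : ∀ k' ∈ keys' S kmem' K, 0 ≤ LIVE' K k') :
    ∀ k' ∈ keys' S kmem' K, LIVE' K k' ≤
      ∑ k'' ∈ (keys' S kmem' K).filter (fun k'' => ktrunc K k'' = ktrunc K k'), LIVE' K k'' :=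
  fun k' hk' => Finset.single_le_sum (f := fun k'' => LIVE' K k'')
    (fun k'' hk'' => hL k'' (mem_filter.1 hk'').1) (mem_filter.2 ⟨hk', (rfl : ktrunc K k' = ktrunc K k')⟩)

end Up

/-! ## §4 Sanity (decided toy): two run-B keys over one run-A key -/

section Toy

/-- toy run-B keys: the identity on `Fin 3` [folklore] -/
def kmemToy' : ℕ → Fin 3 → Fin 3 := fun _ i => i

/-- toy key truncation `Fin 3 → Fin 2` (the term truncation of part 1's toy) [folklore] -/
def ktruncToy : ℕ → Fin 3 → Fin 2 := fun _ i => if i.val < 2 then 0 else 1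

/-- the toy key multiplicity of the run-A key `0` is `2` (keys `0, 1 ↦ 0`) [folklore] -/
example : keyMult (fun _ => (Finset.univ : Finset (Fin 3))) kmemToy' ktruncToy 0 0 = 2 := by decide

/-- the toy key multiplicity of the run-A key `1` is `1` (key `2 ↦ 1`) [folklore] -/
example : keyMult (fun _ => (Finset.univ : Finset (Fin 3))) kmemToy' ktruncToy 0 1 = 1 := by decide

end Toy

/-! ## §5 (v1.1, owner gen 48 — RULING R-OWNER-48-2 «THE KEY FIBRE IS RESUMMED BY WEIGHT, NOT COUNTED», adopting refuter
PRICING-NE7b v15 L-v15-1) The WEIGHTED key multiplicity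

CORRECTION OF RECORD (append-only; the sentences above stay as landed and are SUPERSEDED here).  The module docstring's
«THIS is where NE-R1's resummed UV factor per step enters BY NAME», `keyMult`'s «NE-R1's resummed UV factor per step is a
bound on it» and §2's `resumM'_of_keyFibreMass_unif` docstring MIS-TYPE NE-R1: per run-A cube of region, run B's refinement
COUNT is `keyMult ≥ 2^{13176}` (13⁴ sub-cubes per cube; refuter F83 (ii)), so a k′-UNIFORM bound `M` is never affordable and
`resumM'_of_keyFibreMass_unif` ∕ `sum_filter_keys_le_keyMult_mul` ∕ `keyDomination_sup`, though TRUE, are NEVER TO BE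
INSTANTIATED with a k′-uniform `M`.  Print resums WEIGHTS, not choices: [Balaban1989LargeFieldII] p. 389 (1.96)
«Σ_q Σ′ exp(−q½p₀(g_k)) ≤ exp(exp(−½p₀(g_k))·100^d(MR_k)^{−d}|X′∖∪Y_i|)», eaten by (1.95)'s volume decay (Bałaban–Jaffe 1986
p. 254: «the small factors … control the sums over choices for the large field regions»; node U5d: «costs weight, never a
rate»).  (ρ_B) OF RECORD is therefore the WEIGHTED form `resumM'_of_keyFibreMass` (§2), and the affordable companion of
`keyMult` is the WEIGHTED KEY MULTIPLICITY below: each run-B key `k′ ↦ k` enters with its own small weight `w K k′` (for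
the reading: the product of run B's per-sub-cube small factors at its finest scale), and what the END pays is
`Σ_{k′ ↦ k} w K k′` — print's `exp(e^{−u_B}·vol∕M^d)`-type absorption, NIL —, never `#{k′ ↦ k}`. -/

section Weighted

variable {ι ι' κ κ' : Type*} [DecidableEq ι] [DecidableEq κ] [DecidableEq κ']
  {trunc : ℕ → ι' → ι} {S : ℕ → Finset ι'} {T : ℕ → Finset ι} {kmem : ℕ → ι → κ} {kmem' : ℕ → ι' → κ'}
  {ktrunc : ℕ → κ' → κ} {K : ℕ} {t : ℝ} {k : κ} {d : ℕ → ℝ → ι' → ℝ}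

variable (S kmem' ktrunc) in
/-- **THE WEIGHTED KEY MULTIPLICITY of a run-A key `k`** ([our object]): `wkeyMult w K k = Σ_{k′ ∈ keys′ K, ktrunc k′ = k} w K k′`
— the run-B keys over `k` counted WITH their small weights (print's resummation (1.96) p. 389 by name; at `w ≡ 1` it is
`keyMult`). [folklore] -/
def wkeyMult (w : ℕ → κ' → ℝ) (K : ℕ) (k : κ) : ℝ :=
  ∑ k' ∈ (keys' S kmem' K).filter (fun k' => ktrunc K k' = k), w K k'

/-- at unit weights the weighted multiplicity IS the count [folklore] -/
theorem wkeyMult_one : wkeyMult S kmem' ktrunc (fun _ _ => (1 : ℝ)) K k = (keyMult S kmem' ktrunc K k : ℝ) := by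
  unfold wkeyMult keyMult
  rw [Finset.sum_const, nsmul_eq_mul, mul_one]

/-- the weighted multiplicity is nonnegative for nonnegative weights [folklore] -/
theorem wkeyMult_nonneg {w : ℕ → κ' → ℝ} (hw : ∀ k' ∈ keys' S kmem' K, 0 ≤ w K k') :
    0 ≤ wkeyMult S kmem' ktrunc w K k :=
  Finset.sum_nonneg fun k' hk' => hw k' (mem_filter.1 hk').1

/-- the weighted multiplicity is monotone in the weights [folklore] -/
theorem wkeyMult_mono {w w' : ℕ → κ' → ℝ} (hw : ∀ k' ∈ keys' S kmem' K, ktrunc K k' = k → w K k' ≤ w' K k') :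
    wkeyMult S kmem' ktrunc w K k ≤ wkeyMult S kmem' ktrunc w' K k :=
  Finset.sum_le_sum fun k' hk' => hw k' (mem_filter.1 hk').1 (mem_filter.1 hk').2

/-- **A WEIGHT-CARRYING per-key bound sums to the WEIGHTED multiplicity times the common factor**: if
`B′ K k′ ≤ w K k′ · M` on the run-B keys over `k`, then `Σ_{k′ ↦ k} B′ K k′ ≤ wkeyMult w K k · M` (the affordable twin of
`sum_filter_keys_le_keyMult_mul`). [folklore] -/
theorem sum_filter_keys_le_wkeyMult_mul (B' w : ℕ → κ' → ℝ) {M : ℝ}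
    (hM : ∀ k' ∈ keys' S kmem' K, ktrunc K k' = k → B' K k' ≤ w K k' * M) :
    ∑ k' ∈ (keys' S kmem' K).filter (fun k' => ktrunc K k' = k), B' K k' ≤ wkeyMult S kmem' ktrunc w K k * M := by
  unfold wkeyMult
  rw [Finset.sum_mul]
  exact Finset.sum_le_sum fun k' hk' => hM k' (mem_filter.1 hk').1 (mem_filter.1 hk').2

/-- **THE END's `resumM'` WITH THE WEIGHTED KEY MULTIPLICITY AS A FACTOR** ((ρ_B) of record in the affordable form,
R-OWNER-48-2): run B's OWN per-key fibre-mass display CARRYING ITS SMALL WEIGHT, `Σ_{τ′ ∈ fibre k′} dead′ ≤ w K k′ · M K k`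
for the run-B keys `k′ ↦ k`, gives `Σ_{τ ∈ fibre k} aggW dead′ ≤ wkeyMult w K k · M K k` — what the END pays for run B's
refinement is `wkeyMult`, print's (1.96)-type absorbed sum of small factors, NOT the count `keyMult`. [folklore] -/
theorem resumM'_of_keyFibreMass_weighted (htr : ∀ τ' ∈ S K, trunc K τ' ∈ T K)
    (hcompat : ∀ τ' ∈ S K, kmem K (trunc K τ') = ktrunc K (kmem' K τ')) (w : ℕ → κ' → ℝ) (M : ℕ → κ → ℝ)
    (hρ : ∀ k' ∈ keys' S kmem' K, ktrunc K k' = k → ∑ τ' ∈ fibre kmem' S K k', d K t τ' ≤ w K k' * M K k) :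
    ∑ τ ∈ fibre kmem T K k, aggW trunc S d K t τ ≤ wkeyMult S kmem' ktrunc w K k * M K k := by
  rw [sum_fibre_aggW_eq, sum_truncFibre_eq_sum_keys htr hcompat]
  exact sum_filter_keys_le_wkeyMult_mul (fun K k' => ∑ τ' ∈ fibre kmem' S K k', d K t τ') w hρ

/-- **… AND WITH THE ABSORPTION DISPLAYED**: if moreover `wkeyMult w K k ≤ A K k` (print's `exp(e^{−u_B}·vol∕M^d)`, a
located NIL display) and `0 ≤ M K k`, then `Σ_{τ ∈ fibre k} aggW dead′ ≤ A K k · M K k` — the END's `resumM′` with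
`RfM′ K k := A K k · M K k`. [folklore] -/
theorem resumM'_of_keyFibreMass_absorbed (htr : ∀ τ' ∈ S K, trunc K τ' ∈ T K)
    (hcompat : ∀ τ' ∈ S K, kmem K (trunc K τ') = ktrunc K (kmem' K τ')) (w : ℕ → κ' → ℝ) (M A : ℕ → κ → ℝ)
    (hρ : ∀ k' ∈ keys' S kmem' K, ktrunc K k' = k → ∑ τ' ∈ fibre kmem' S K k', d K t τ' ≤ w K k' * M K k)
    (hA : wkeyMult S kmem' ktrunc w K k ≤ A K k) (hM : 0 ≤ M K k) :
    ∑ τ ∈ fibre kmem T K k, aggW trunc S d K t τ ≤ A K k * M K k :=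
  (resumM'_of_keyFibreMass_weighted htr hcompat w M hρ).trans (mul_le_mul_of_nonneg_right hA hM)

end Weighted

/-! ## §6 Sanity (decided toy, continued): the weighted multiplicity of the toy -/

section ToyW

/-- at weights `½` the toy's weighted multiplicity of the run-A key `0` is `½ + ½ = 1` (its count is `2`) [folklore] -/
example : wkeyMult (fun _ => (Finset.univ : Finset (Fin 3))) kmemToy' ktruncToy (fun _ _ => (1 / 2 : ℝ)) 0 0 = 1 := by
  unfold wkeyMult keys'
  rw [show ((Finset.univ : Finset (Fin 3)).image (kmemToy' 0)).filter (fun k' => ktruncToy 0 k' = 0) = {0, 1} from by decide]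
  norm_num

end ToyW

end

end Summit.QuantumFields.BalabanUV.T4Continuum.B16HistoryIndexedTruncKeys
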